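import Literature.NumberTheory.EllipticCurves.TianYuanZhang2017.CMPointThetaSignatureDisplays
import Literature.NumberTheory.ComplexMultiplication.CMLatticeRingClassTowerTwoOverClassGroup
import Literature.NumberTheory.QuadraticFields.DiscriminantOfSqrt
import HarnessLib

/-!
# Tian–Yuan–Zhang 2017 Prop. 3.2 (1)(2) and §3.1 in the ring class dictionary — PROVED (theorems only, no named fact):
# `ρ₄(θ_d)` has order `4`, generates `ker(Pic(𝒪₄) → Cl(𝒪_{K_d}))`, and is not a square; `ρ₄(σ_d) = ρ₄(θ_d)²` is the UNIQUE involution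
# of that kernel (blocks `d ≡ 6 (mod 8)`); `ker(Pic(𝒪₂) → Cl(𝒪_{K_d})) = {1, ρ₂(σ_d)}` (blocks `d ≡ 5 (mod 8)`)

Companion to `CMPointRingClassDisplays.lean`, whose module docstring says: "(RC2) … Consequently `ρ_d(σ d)` is THE non-trivial element of
that kernel for `d ≡ 5` (order `2` = `[H′_n : H_n]`, Prop. 3.2 (1)), and `ρ_d(θ d)` generates it (`≅ ℤ/4`) for `d ≡ 6` — derivable from
(G6)/(G8) of `CMPointGaloisPrinted` and (RC1)–(RC2), not displayed separately."  THIS file is that derivation, as kernel theorems (no `def`,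
no new `Prop`; net debt 0), for the consumers of the cell `bsd-print-cf2` (crux stmt-BirchSwinnertonDyer-20509, the «genus-regime law» of
the cruxlead's workfile `Summits/…/Cruxes/RamifiedOffTYZOfFacts/Lines/offtyz_v7_EvenTwoPrimes.md` §5, §11: "`G = Pic(𝒪₄)`, `π : G ↠ C = Cl(𝒪_K)`,
`ker π = ⟨θ⟩ ≅ ℤ/4` (`θ = [1 + √−2m] = σ_{1+ϖ}`), `σ = θ²`; … `θ ∉ G²` (squares fix `i`)").

## THE PRINT

* [TianYuanZhang2017] **Prop. 3.2** (arXiv:1411.4728 chunk p0010 L106–L113; J738): "(1) Assume that `n ≡ 5 (mod 8)`. Then `Gal(H′_n/H_n) ≃ ℤ/2ℤ`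
  is generated by `σ_ϖ²`. … (2) Assume that `n ≡ 6 (mod 8)`. Then `Gal(H′_n/H_n) ≃ ℤ/4ℤ` is generated by `σ_{1+ϖ}`. Here `ϖ = (√−n)₂ ∈ K_{n,2}^×`.
  The subfield of `H′_n` fixed by `σ²_{1+ϖ}` is `H_n(i)`. The field `H′_n` is exactly the ring class field of conductor `4` over `K_n`";
  **§3.1** (p0011 L1–L4, L8–L9): "Let `σ` be the unique order-two element of `Gal(H′_n/H_n)` in the case `n ≡ 5, 6 (mod 8)`", "it suffices to
  check that `σ = σ²_{1+ϖ}` …", "Note that `σ_{1+ϖ} ∉ Cl′_n`" (`Cl′_n = Gal(H′_n/K_n(i))`).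
* [Cox2013] **§7.D Thm. 7.24** (p. 146): "`h(𝒪) = h(𝒪_K) f / [𝒪_K^* : 𝒪^*] · ∏_{p ∣ f} (1 − (d_K/p) 1/p)`"; (7.25)–(7.27), Prop. 7.22, §9.A
  (pp. 180–181: the ring class field of the order of conductor `f`, `Gal(L/K) ≅ C(𝒪)`).  In the tree: `CMTypeLattice.natCard_ker_toClassGroup_two_pow_of_even`
  («`#ker(I_K(2^n)/P_{K,ℤ}(2^n) → Cl(𝒪_K)) = 2^n` for `2 ∣ d_K`, `d_K ≠ −4`, `n ≥ 1`»), applied to `K = K_d = ℚ(√−d)`, `d_{K_d} = −4d`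
  (square-free `d ≡ 5, 6 (mod 8)`; the tree's `Quadratic.discr_eq_four_mul_of_sq_eq_intCast_of_neg`).

## WHAT IS PROVED (tree currency: `CMBlockSpec`, `ThetaBlockSpec`, `RingClassTwoBlockSpec` / `RingClassFourBlockSpec`, `ThetaSignatureBlockSpec`)

For a block `d` of `D : GenusPointData n` with the displayed objects `z, Φ, ΓH = Gal(ℍ′_n/H_d), ΓH' = Gal(ℍ′_n/H′_d), σ, θ, c` and a ring class
dictionary `ρ : Gal(ℍ′_n/K_d) → Pic(𝒪_f)` (`f = 4` for `d ≡ 6`, `f = 2` for `d ≡ 5`):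
* (§2) `σ ∈ Gal(ℍ′_n/K_d)`, `σ ∉ ΓH'` (it moves `z_d`: `z_d^σ = z_d + τ(1)`, `τ(1) ≠ 0`), so `ρ(σ) ≠ 1`, `ρ(σ)² = 1`, `orderOf ρ(σ) = 2`, `ρ(σ) ∈ ker(→ Cl)`;
* (§3, `d ≡ 6`) `ρ₄(θ)² = ρ₄(σ)`, `ρ₄(θ)⁴ = 1`, `orderOf ρ₄(θ) = 4`, `ρ₄(θ) ∈ ker(Pic(𝒪₄) → Cl(𝒪_{K_d}))`;
* (§4, `d ≡ 6`, `d` square-free) `ker(Pic(𝒪₄) → Cl(𝒪_{K_d})) = ⟨ρ₄(θ)⟩` (both have `4` elements), and every `x` in the kernel with `x² = 1` is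
  `1` or `ρ₄(σ)` — Galois form: `g ∈ Gal(ℍ′_n/H_d)` with `g² ∈ Gal(ℍ′_n/H′_d)` is `≡ 1` or `≡ σ` modulo `Gal(ℍ′_n/H′_d)` (Prop. 3.2 (2): `Gal(H′_d/H_d) ≅ ℤ/4`);
* (§5, `d ≡ 6`) with the genus signature (`θ(i) = −i`, `ThetaSignatureBlockSpec`): `ρ₄(θ)` is NOT a square in `Pic(𝒪₄)` ("`σ_{1+ϖ} ∉ Cl′_n`";
  the workfile's "`θ ∉ G²` (squares fix `i`)");
* (§6, `d ≡ 5`, `d` square-free) `ker(Pic(𝒪₂) → Cl(𝒪_{K_d})) = {1, ρ₂(σ)}` — Galois form: `g ∈ Gal(ℍ′_n/H_d)` is `≡ 1` or `≡ σ` modulo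
  `Gal(ℍ′_n/H′_d)` (Prop. 3.2 (1): `Gal(H′_d/H_d) ≅ ℤ/2`).
HONEST FRAMING: theorems only; every hypothesis is one of the cell's displayed predicates (nothing is asserted about their truth); no count moves;
BSD is not proved by any of this.  Cell `bsd-print-cf2`, typer seat ty2 (g40).

References: [TianYuanZhang2017] Prop. 3.2 (1)(2) (p0010 L106–L113), §3.1 (p0011 L1–L13); [Cox2013] §7.D Thm. 7.24, (7.25)–(7.27), Prop. 7.22,
§9.A (pp. 180–181); the cell workfile `Summits/BirchSwinnertonDyer/BirchSwinnertonDyer/Cruxes/RamifiedOffTYZOfFacts/Lines/offtyz_v7_EvenTwoPrimes.md`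
§5, §11 (consumer).
-/

noncomputable section

open scoped Classical nonZeroDivisors

open NumberField Module

namespace Literature.NumberTheory.EllipticCurves.TianYuanZhang2017

open Literature.NumberTheory.QuadraticFields.RingClass Literature.NumberTheory.QuadraticFields
open Literature.NumberTheory.ComplexMultiplication
open Literature.NumberTheory.EllipticCurves (isImaginaryQuadratic_iff_isCMField isImaginaryQuadratic_iff_discr_neg)

/-! ## §1 `K_d = ℚ(√−d)` for a square-free block `d ≡ 5, 6 (mod 8)`: `d_{K_d} = −4d` (even, `≠ −4`), `K_d` is a CM field -/

/-- `d_{K_d} = −4d` for square-free `d ≡ 5, 6 (mod 8)` (`−d ≡ 3, 2 (mod 4)`).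
[cite: Cox2013, §5.B (5.12)–(5.13), p. 104] [cite: TianYuanZhang2017, §1 (p0002 L78–L82: `K = ℚ(√−d)`)] -/
theorem discr_genusField_of_mod_eight {d : ℕ} (hsq : Squarefree d) (hd : d % 8 = 5 ∨ d % 8 = 6) :
    NumberField.discr (GenusField d) = -4 * d ∧ Even (NumberField.discr (GenusField d)) ∧
      NumberField.discr (GenusField d) ≠ -4 ∧ NumberField.discr (GenusField d) < 0 := by
  have hd1 : 1 ≤ d := by omega
  have hroot : (AdjoinRoot.root (genusFieldPoly d)) ^ 2 = ((-(d : ℤ) : ℤ) : GenusField d) := by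
    rw [root_genusField_sq hd1]; push_cast; ring
  have hsf : Squarefree (-(d : ℤ)) := Int.squarefree_natAbs.mp (by simpa using hsq)
  have h := (Quadratic.discr_eq_four_mul_of_sq_eq_intCast_of_neg (finrank_genusField d) hroot (by omega)
    (by omega) hsf).1
  refine ⟨by rw [h]; ring, ⟨-2 * d, by rw [h]; ring⟩, by rw [h]; omega, by rw [h]; omega⟩

/-- `K_d` is a CM field (imaginary quadratic: `[K_d : ℚ] = 2`, `d_{K_d} < 0`). [cite: Cox2013, §5.B p. 104 and §7.A] -/
theorem isCMField_genusField_of_mod_eight {d : ℕ} (hsq : Squarefree d) (hd : d % 8 = 5 ∨ d % 8 = 6) :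
    IsCMField (GenusField d) :=
  (isImaginaryQuadratic_iff_isCMField.mp
    (isImaginaryQuadratic_iff_discr_neg.mpr ⟨finrank_genusField d, (discr_genusField_of_mod_eight hsq hd).2.2.2⟩)).2

/-- `#ker(Pic(𝒪₄)(K_d) → Cl(𝒪_{K_d})) = 4` for square-free `d ≡ 5, 6 (mod 8)` (Cox Thm. 7.24: `h(𝒪₄) = 4·h(𝒪_K)·(1 − 0)/1`).
[cite: Cox2013, §7.D Thm. 7.24 and (7.27), pp. 146–147] -/
theorem natCard_ker_toClassGroup_four_genusField {d : ℕ} (hsq : Squarefree d) (hd : d % 8 = 5 ∨ d % 8 = 6) :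
    Nat.card (toClassGroup (GenusField d) 4).ker = 4 := by
  haveI := isCMField_genusField_of_mod_eight hsq hd
  obtain ⟨-, heven, hd4, -⟩ := discr_genusField_of_mod_eight hsq hd
  have H := CMTypeLattice.natCard_ker_toClassGroup_two_pow_of_even (finrank_genusField d) heven hd4 (n := 2) (by norm_num)
  simpa using H

/-- `#ker(Pic(𝒪₂)(K_d) → Cl(𝒪_{K_d})) = 2` for square-free `d ≡ 5, 6 (mod 8)` (Cox Thm. 7.24: `h(𝒪₂) = 2·h(𝒪_K)`).
[cite: Cox2013, §7.D Thm. 7.24 and (7.27), pp. 146–147] -/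
theorem natCard_ker_toClassGroup_two_genusField {d : ℕ} (hsq : Squarefree d) (hd : d % 8 = 5 ∨ d % 8 = 6) :
    Nat.card (toClassGroup (GenusField d) 2).ker = 2 := by
  haveI := isCMField_genusField_of_mod_eight hsq hd
  obtain ⟨-, heven, hd4, -⟩ := discr_genusField_of_mod_eight hsq hd
  have H := CMTypeLattice.natCard_ker_toClassGroup_two_pow_of_even (finrank_genusField d) heven hd4 (n := 1) le_rfl
  simpa using H

namespace GenusPointData

variable {n : ℕ} {D : GenusPointData n} {d : ℕ} {z : APoint D.H} {Φ : Finset (D.H ≃ₐ[ℚ] D.H)}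
  {ΓH ΓH' : Subgroup (D.H ≃ₐ[ℚ] D.H)} {σ θ c : D.H ≃ₐ[ℚ] D.H}

/-! ## §2 The order-two element `σ` of a block `d ≡ 5, 6 (mod 8)` -/

/-- Every element of `Gal(ℍ′_n/H_d)` fixes `√−d` ((G4): it is trivial on the genus field `L_d ∋ √−d`).
[cite: TianYuanZhang2017, §2.1 (J725 L11–L16) and §3.1 (p0011 L1–L13)] -/
theorem CMBlockSpec.mem_galK_of_mem (h : D.CMBlockSpec d z Φ ΓH ΓH' σ c) {g : D.H ≃ₐ[ℚ] D.H} (hg : g ∈ ΓH) :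
    g ∈ D.galK d :=
  (h.2.2.2.1.2 g hg).1

/-- `Gal(ℍ′_n/H′_d) ≤ Gal(ℍ′_n/K_d)`. [cite: TianYuanZhang2017, §3.1 (p0011 L1–L13)] -/
theorem CMBlockSpec.mem_galK_of_mem' (h : D.CMBlockSpec d z Φ ΓH ΓH' σ c) {g : D.H ≃ₐ[ℚ] D.H} (hg : g ∈ ΓH') :
    g ∈ D.galK d :=
  h.mem_galK_of_mem (h.2.2.2.1.1 g hg)

/-- `σ ∈ Gal(ℍ′_n/K_d)` (`σ ∈ Gal(ℍ′_n/H_d)`, (G6)). [cite: TianYuanZhang2017, §3.1 (p0011 L3)] -/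
theorem CMBlockSpec.sigma_mem_galK (h : D.CMBlockSpec d z Φ ΓH ΓH' σ c) : σ ∈ D.galK d :=
  h.mem_galK_of_mem h.2.2.2.2.2.1.1

/-- **`σ ∉ Gal(ℍ′_n/H′_d)`**: `σ` moves `z_d` (`z_d^σ = z_d + τ(1)`, `τ(1) ≠ 0`) while `Gal(ℍ′_n/H′_d)` fixes it — "`σ` the unique order-two
element of `Gal(H′_n/H_n)`" is non-trivial on `H′_d`. [cite: TianYuanZhang2017, §3.1 (p0011 L3), Thm. 3.6 (1)(2) (p0012 L27–L33)] -/
theorem CMBlockSpec.sigma_not_mem (h : D.CMBlockSpec d z Φ ΓH ΓH' σ c) : σ ∉ ΓH' := by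
  intro hσ
  have e := h.2.2.1.1 σ hσ
  rw [h.2.2.2.2.2.1.2.2, add_eq_left] at e
  exact tauOne_ne_zero e

section Four

variable {ρ : D.galK d →* RingClassGroup (GenusField d) 4}

/-- `ρ₄(σ) ≠ 1` ((RC1): `ker ρ₄ = Gal(ℍ′_n/H′_d) ∌ σ`). [cite: TianYuanZhang2017, Prop. 3.2 (2) (p0010 L111–L113), §3.1 (p0011 L3)] -/
theorem RingClassFourBlockSpec.rho_sigma_ne_one (hRC : D.RingClassFourBlockSpec d ΓH ΓH' ρ)
    (h : D.CMBlockSpec d z Φ ΓH ΓH' σ c) : ρ ⟨σ, h.sigma_mem_galK⟩ ≠ 1 :=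
  fun e => h.sigma_not_mem ((hRC.2.1 _).1 e)

/-- `ρ₄(σ)·ρ₄(σ) = 1` (`σ² ∈ Gal(ℍ′_n/H′_d)`, (G6) + (RC1)). [cite: TianYuanZhang2017, §3.1 (p0011 L3), Prop. 3.2 (2)] -/
theorem RingClassFourBlockSpec.rho_sigma_mul_self (hRC : D.RingClassFourBlockSpec d ΓH ΓH' ρ)
    (h : D.CMBlockSpec d z Φ ΓH ΓH' σ c) : ρ ⟨σ, h.sigma_mem_galK⟩ * ρ ⟨σ, h.sigma_mem_galK⟩ = 1 := by
  rw [← map_mul]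
  exact (hRC.2.1 _).2 h.2.2.2.2.2.1.2.1

/-- `orderOf ρ₄(σ) = 2` ("the unique order-two element"). [cite: TianYuanZhang2017, §3.1 (p0011 L3), Prop. 3.2 (2)] -/
theorem RingClassFourBlockSpec.orderOf_rho_sigma (hRC : D.RingClassFourBlockSpec d ΓH ΓH' ρ)
    (h : D.CMBlockSpec d z Φ ΓH ΓH' σ c) : orderOf (ρ ⟨σ, h.sigma_mem_galK⟩) = 2 :=
  orderOf_eq_prime (by simpa [pow_two] using hRC.rho_sigma_mul_self h) (hRC.rho_sigma_ne_one h)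

/-- `ρ₄(σ) ∈ ker(Pic(𝒪₄) → Cl(𝒪_{K_d}))` (`σ ∈ Gal(ℍ′_n/H_d)`, (RC2)). [cite: TianYuanZhang2017, §3.1 (p0011 L3), Prop. 3.2 (2)] [cite: Cox2013, §9.A (pp. 180–181)] -/
theorem RingClassFourBlockSpec.toClassGroup_rho_sigma (hRC : D.RingClassFourBlockSpec d ΓH ΓH' ρ)
    (h : D.CMBlockSpec d z Φ ΓH ΓH' σ c) : toClassGroup (GenusField d) 4 (ρ ⟨σ, h.sigma_mem_galK⟩) = 1 :=
  (hRC.2.2.1 _).2 h.2.2.2.2.2.1.1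

/-! ## §3 `θ = σ_{1+ϖ}` of a block `d ≡ 6 (mod 8)`: `ρ₄(θ)² = ρ₄(σ)`, order `4`, in the kernel -/

/-- `θ ∈ Gal(ℍ′_n/K_d)` (`θ` fixes `√−d`, (G8)). [cite: TianYuanZhang2017, Prop. 3.2 (2) (p0010 L111–L113)] -/
theorem ThetaBlockSpec.mem_galK (hT : D.ThetaBlockSpec d z ΓH ΓH' σ θ) : θ ∈ D.galK d :=
  hT.1

/-- **`ρ₄(θ)·ρ₄(θ) = ρ₄(σ)`** ("`σ = σ²_{1+ϖ}`": `θ·θ·σ⁻¹ ∈ Gal(ℍ′_n/H′_d) = ker ρ₄`). [cite: TianYuanZhang2017, §3.1 (p0011 L8), Prop. 3.2 (2)] -/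
theorem RingClassFourBlockSpec.rho_theta_mul_self (hRC : D.RingClassFourBlockSpec d ΓH ΓH' ρ)
    (h : D.CMBlockSpec d z Φ ΓH ΓH' σ c) (hT : D.ThetaBlockSpec d z ΓH ΓH' σ θ) :
    ρ ⟨θ, hT.mem_galK⟩ * ρ ⟨θ, hT.mem_galK⟩ = ρ ⟨σ, h.sigma_mem_galK⟩ := by
  have e : ρ (⟨θ, hT.mem_galK⟩ * ⟨θ, hT.mem_galK⟩ * ⟨σ, h.sigma_mem_galK⟩⁻¹) = 1 := (hRC.2.1 _).2 hT.2.2.2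
  rwa [map_mul, map_inv, mul_inv_eq_one, map_mul] at e

/-- `ρ₄(θ) ^ 4 = 1`. [cite: TianYuanZhang2017, Prop. 3.2 (2) (p0010 L111–L113)] -/
theorem RingClassFourBlockSpec.rho_theta_pow_four (hRC : D.RingClassFourBlockSpec d ΓH ΓH' ρ)
    (h : D.CMBlockSpec d z Φ ΓH ΓH' σ c) (hT : D.ThetaBlockSpec d z ΓH ΓH' σ θ) :
    ρ ⟨θ, hT.mem_galK⟩ ^ 4 = 1 := by
  have e : ρ ⟨θ, hT.mem_galK⟩ ^ 4 = (ρ ⟨θ, hT.mem_galK⟩ * ρ ⟨θ, hT.mem_galK⟩) * (ρ ⟨θ, hT.mem_galK⟩ * ρ ⟨θ, hT.mem_galK⟩) := by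
    simp only [pow_succ, pow_zero, one_mul, mul_assoc]
  rw [e, hRC.rho_theta_mul_self h hT]
  exact hRC.rho_sigma_mul_self h

/-- `ρ₄(θ) ^ 2 ≠ 1` (it is `ρ₄(σ) ≠ 1`). [cite: TianYuanZhang2017, Prop. 3.2 (2), §3.1 (p0011 L3, L8)] -/
theorem RingClassFourBlockSpec.rho_theta_sq_ne_one (hRC : D.RingClassFourBlockSpec d ΓH ΓH' ρ)
    (h : D.CMBlockSpec d z Φ ΓH ΓH' σ c) (hT : D.ThetaBlockSpec d z ΓH ΓH' σ θ) :
    ρ ⟨θ, hT.mem_galK⟩ ^ 2 ≠ 1 := by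
  rw [pow_two (ρ ⟨θ, hT.mem_galK⟩), hRC.rho_theta_mul_self h hT]; exact hRC.rho_sigma_ne_one h

/-- **`orderOf ρ₄(θ) = 4`** ("`Gal(H′_n/H_n) ≃ ℤ/4ℤ` is generated by `σ_{1+ϖ}`"). [cite: TianYuanZhang2017, Prop. 3.2 (2) (p0010 L111–L113)] -/
theorem RingClassFourBlockSpec.orderOf_rho_theta (hRC : D.RingClassFourBlockSpec d ΓH ΓH' ρ)
    (h : D.CMBlockSpec d z Φ ΓH ΓH' σ c) (hT : D.ThetaBlockSpec d z ΓH ΓH' σ θ) :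
    orderOf (ρ ⟨θ, hT.mem_galK⟩) = 4 := by
  have H := orderOf_eq_prime_pow (p := 2) (n := 1) (x := ρ ⟨θ, hT.mem_galK⟩)
    (by simpa using hRC.rho_theta_sq_ne_one h hT) (by simpa using hRC.rho_theta_pow_four h hT)
  simpa using H

/-- `ρ₄(θ) ∈ ker(Pic(𝒪₄) → Cl(𝒪_{K_d}))` (`θ ∈ Gal(ℍ′_n/H_d)`, (RC2)). [cite: TianYuanZhang2017, Prop. 3.2 (2)] [cite: Cox2013, §9.A (pp. 180–181)] -/
theorem RingClassFourBlockSpec.toClassGroup_rho_theta (hRC : D.RingClassFourBlockSpec d ΓH ΓH' ρ)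
    (hT : D.ThetaBlockSpec d z ΓH ΓH' σ θ) : toClassGroup (GenusField d) 4 (ρ ⟨θ, hT.mem_galK⟩) = 1 :=
  (hRC.2.2.1 _).2 hT.2.2.1

/-! ## §4 `ker(Pic(𝒪₄) → Cl(𝒪_{K_d})) = ⟨ρ₄(θ)⟩ ≅ ℤ/4`; `ρ₄(σ)` is its unique involution -/

/-- **`ker(Pic(𝒪₄)(K_d) → Cl(𝒪_{K_d})) = ⟨ρ₄(θ_d)⟩`** for a square-free block `d ≡ 6 (mod 8)`: both sides have `4` elements (Cox Thm. 7.24;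
`orderOf ρ₄(θ) = 4`). [cite: TianYuanZhang2017, Prop. 3.2 (2) (p0010 L111–L113)] [cite: Cox2013, §7.D Thm. 7.24 and (7.27), §9.A] -/
theorem RingClassFourBlockSpec.ker_toClassGroup_eq_zpowers_rho_theta (hRC : D.RingClassFourBlockSpec d ΓH ΓH' ρ)
    (h : D.CMBlockSpec d z Φ ΓH ΓH' σ c) (hT : D.ThetaBlockSpec d z ΓH ΓH' σ θ) (hsq : Squarefree d) (hd6 : d % 8 = 6) :
    (toClassGroup (GenusField d) 4).ker = Subgroup.zpowers (ρ ⟨θ, hT.mem_galK⟩) := by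
  have hcard := natCard_ker_toClassGroup_four_genusField hsq (Or.inr hd6)
  haveI : Finite (toClassGroup (GenusField d) 4).ker := Nat.finite_of_card_ne_zero (by rw [hcard]; norm_num)
  have hle : Subgroup.zpowers (ρ ⟨θ, hT.mem_galK⟩) ≤ (toClassGroup (GenusField d) 4).ker := by
    rw [Subgroup.zpowers_le, MonoidHom.mem_ker]; exact hRC.toClassGroup_rho_theta hT
  have hcard' : Nat.card (Subgroup.zpowers (ρ ⟨θ, hT.mem_galK⟩)) = 4 := by
    rw [Nat.card_zpowers, hRC.orderOf_rho_theta h hT]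
  exact (Subgroup.eq_of_le_of_card_ge hle (by rw [hcard, hcard'])).symm

/-- **`ρ₄(σ_d)` is the UNIQUE involution of `ker(Pic(𝒪₄) → Cl(𝒪_{K_d}))`** (square-free block `d ≡ 6 (mod 8)`): an `x` in the kernel with
`x·x = 1` is `1` or `ρ₄(σ)` ("`σ` the unique order-two element of `Gal(H′_n/H_n) ≃ ℤ/4ℤ`").
[cite: TianYuanZhang2017, Prop. 3.2 (2) (p0010 L111–L113), §3.1 (p0011 L3)] [cite: Cox2013, §7.D Thm. 7.24, §9.A] -/
theorem RingClassFourBlockSpec.eq_one_or_eq_rho_sigma (hRC : D.RingClassFourBlockSpec d ΓH ΓH' ρ)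
    (h : D.CMBlockSpec d z Φ ΓH ΓH' σ c) (hT : D.ThetaBlockSpec d z ΓH ΓH' σ θ) (hsq : Squarefree d) (hd6 : d % 8 = 6)
    {x : RingClassGroup (GenusField d) 4} (hx : toClassGroup (GenusField d) 4 x = 1) (hx2 : x * x = 1) :
    x = 1 ∨ x = ρ ⟨σ, h.sigma_mem_galK⟩ := by
  have hmem : x ∈ Subgroup.zpowers (ρ ⟨θ, hT.mem_galK⟩) := by
    rw [← hRC.ker_toClassGroup_eq_zpowers_rho_theta h hT hsq hd6, MonoidHom.mem_ker]; exact hx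
  obtain ⟨k, hk⟩ := Subgroup.mem_zpowers_iff.mp hmem
  -- `x = ρ(θ)^k`, `x² = 1` ⟹ `4 ∣ 2k` ⟹ `k = 2j` ⟹ `x = ρ(σ)^j = ρ(σ)^{j mod 2}`
  have hts : ρ ⟨θ, hT.mem_galK⟩ ^ (2 : ℤ) = ρ ⟨σ, h.sigma_mem_galK⟩ :=
    (zpow_two (ρ ⟨θ, hT.mem_galK⟩)).trans (hRC.rho_theta_mul_self h hT)
  have h4 : ((4 : ℕ) : ℤ) ∣ 2 * k := by
    rw [← hRC.orderOf_rho_theta h hT, orderOf_dvd_iff_zpow_eq_one]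
    calc ρ ⟨θ, hT.mem_galK⟩ ^ (2 * k) = ρ ⟨θ, hT.mem_galK⟩ ^ (k + k) := by rw [two_mul]
      _ = ρ ⟨θ, hT.mem_galK⟩ ^ k * ρ ⟨θ, hT.mem_galK⟩ ^ k := zpow_add (ρ ⟨θ, hT.mem_galK⟩) k k
      _ = 1 := by rw [hk]; exact hx2
  obtain ⟨j, hj⟩ : (2 : ℤ) ∣ k := by omega
  have e : x = ρ ⟨σ, h.sigma_mem_galK⟩ ^ (j % 2) :=
    calc x = ρ ⟨θ, hT.mem_galK⟩ ^ (2 * j) := by rw [← hk, hj]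
      _ = (ρ ⟨θ, hT.mem_galK⟩ ^ (2 : ℤ)) ^ j := zpow_mul (ρ ⟨θ, hT.mem_galK⟩) 2 j
      _ = ρ ⟨σ, h.sigma_mem_galK⟩ ^ j := by rw [hts]
      _ = ρ ⟨σ, h.sigma_mem_galK⟩ ^ (j % (orderOf (ρ ⟨σ, h.sigma_mem_galK⟩) : ℤ)) := (zpow_mod_orderOf _ j).symm
      _ = ρ ⟨σ, h.sigma_mem_galK⟩ ^ (j % 2) := by rw [hRC.orderOf_rho_sigma h]; rfl
  rcases Int.emod_two_eq_zero_or_one j with hj' | hj'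
  · left; rw [e, hj']; exact zpow_zero _
  · right; rw [e, hj']; exact zpow_one _

/-- **Galois form of §4** (square-free block `d ≡ 6 (mod 8)`): an automorphism `g ∈ Gal(ℍ′_n/H_d)` with `g² ∈ Gal(ℍ′_n/H′_d)` is `≡ 1` or `≡ σ`
modulo `Gal(ℍ′_n/H′_d)` (`Gal(H′_d/H_d) ≅ ℤ/4` has one involution). [cite: TianYuanZhang2017, Prop. 3.2 (2) (p0010 L111–L113), §3.1 (p0011 L3)] -/
theorem RingClassFourBlockSpec.mem_or_mul_inv_sigma_mem (hRC : D.RingClassFourBlockSpec d ΓH ΓH' ρ)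
    (h : D.CMBlockSpec d z Φ ΓH ΓH' σ c) (hT : D.ThetaBlockSpec d z ΓH ΓH' σ θ) (hsq : Squarefree d) (hd6 : d % 8 = 6)
    {g : D.H ≃ₐ[ℚ] D.H} (hg : g ∈ ΓH) (hg2 : g * g ∈ ΓH') : g ∈ ΓH' ∨ g * σ⁻¹ ∈ ΓH' := by
  have hgK : g ∈ D.galK d := h.mem_galK_of_mem hg
  have hx : toClassGroup (GenusField d) 4 (ρ ⟨g, hgK⟩) = 1 := (hRC.2.2.1 ⟨g, hgK⟩).2 hg
  have hx2 : ρ ⟨g, hgK⟩ * ρ ⟨g, hgK⟩ = 1 := by rw [← map_mul]; exact (hRC.2.1 _).2 hg2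
  rcases hRC.eq_one_or_eq_rho_sigma h hT hsq hd6 hx hx2 with e | e
  · exact Or.inl ((hRC.2.1 ⟨g, hgK⟩).1 e)
  · right
    have : ρ (⟨g, hgK⟩ * ⟨σ, h.sigma_mem_galK⟩⁻¹) = 1 := by rw [map_mul, map_inv, e, mul_inv_cancel]
    exact (hRC.2.1 _).1 this

/-! ## §5 With the genus signature: `ρ₄(θ)` is not a square in `Pic(𝒪₄)` -/

/-- Elements of `Gal(ℍ′_n/H′_d) = ker ρ₄` are trivial on `L_d(i)` ((RC3) with `h = 1`). [cite: TianYuanZhang2017, proof of Lemma 3.21 (p0020 L55–L58)] -/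
theorem RingClassFourBlockSpec.trivialOnL_of_rho_eq_one (hRC : D.RingClassFourBlockSpec d ΓH ΓH' ρ) {g : D.galK d}
    (hg : ρ g = 1) : D.TrivialOnL d (g : D.H ≃ₐ[ℚ] D.H) :=
  (hRC.2.2.2 g).2 ⟨1, by simp, by rw [hg, map_one]; exact (one_mul (1 : RingClassGroup (GenusField d) 4)).symm⟩

/-- An automorphism fixing `√−d` squares to an automorphism fixing `i` (`g(i) = ±i`). [cite: TianYuanZhang2017, §3.1 (p0011 L60–L66)] -/
theorem apply_apply_im (g : D.H ≃ₐ[ℚ] D.H) : g (g D.im) = D.im := by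
  have hsq : (g D.im) ^ 2 = D.im ^ 2 := by rw [← map_pow, D.im_sq, map_neg, map_one]
  rcases sq_eq_sq_iff_eq_or_eq_neg.mp hsq with e | e
  · rw [e, e]
  · rw [e, map_neg, e, neg_neg]

/-- `θ(i) = −i` excludes `θ(i) = i` (`i ≠ 0`: `i² = −1`). [cite: TianYuanZhang2017, §3.1 (p0011 L9)] -/
theorem ThetaSignatureBlockSpec.apply_im_ne (hS : D.ThetaSignatureBlockSpec d θ) : θ D.im ≠ D.im := by
  intro h3
  have e : D.im = -D.im := h3.symm.trans hS.apply_im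
  have h2 : (2 : D.H) * D.im = 0 := by linear_combination e
  have him : D.im ≠ 0 := fun h0 => by
    have := D.im_sq
    rw [h0] at this
    norm_num at this
  exact him ((mul_eq_zero.mp h2).resolve_left two_ne_zero)

/-- **`ρ₄(θ_d)` is NOT a square in `Pic(𝒪₄)`** ("`σ_{1+ϖ} ∉ Cl′_n`"; the workfile's "`θ ∉ G²` (squares fix `i`)"): if `ρ₄(θ) = ρ₄(g)² = ρ₄(g²)`
then `θ⁻¹g² ∈ ker ρ₄` is trivial on `L_d(i)`, and `g²(i) = i`, so `θ(i) = i` — contradicting the genus signature `θ(i) = −i`.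
[cite: TianYuanZhang2017, §3.1 (p0011 L9), Prop. 3.2 (2), proof of Lemma 3.21 (p0020 L55–L58)] -/
theorem ThetaSignatureBlockSpec.not_isSquare_rho (hRC : D.RingClassFourBlockSpec d ΓH ΓH' ρ)
    (hS : D.ThetaSignatureBlockSpec d θ) (hθ : θ ∈ D.galK d) : ¬ IsSquare (ρ ⟨θ, hθ⟩) := by
  rintro ⟨r, hr⟩
  obtain ⟨g, rfl⟩ := hRC.1 r
  have hu : ρ (⟨θ, hθ⟩⁻¹ * (g * g)) = 1 := by rw [map_mul, map_inv, map_mul, ← hr, inv_mul_cancel]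
  have h1 := (hRC.trivialOnL_of_rho_eq_one hu).1
  have h2 : (θ * (θ⁻¹ * ((g : D.H ≃ₐ[ℚ] D.H) * (g : D.H ≃ₐ[ℚ] D.H)))) D.im = D.im := by
    rw [mul_inv_cancel_left, AlgEquiv.mul_apply]; exact apply_apply_im _
  have h3 : θ D.im = D.im := by
    rw [AlgEquiv.mul_apply] at h2
    have h1' : (θ⁻¹ * ((g : D.H ≃ₐ[ℚ] D.H) * (g : D.H ≃ₐ[ℚ] D.H))) D.im = D.im := by simpa using h1
    rwa [h1'] at h2
  exact hS.apply_im_ne h3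

/-- Galois form of §5: no `g ∈ Gal(ℍ′_n/K_d)` has `g² ≡ θ` modulo `Gal(ℍ′_n/H′_d)`.
[cite: TianYuanZhang2017, §3.1 (p0011 L9), Prop. 3.2 (2)] -/
theorem ThetaSignatureBlockSpec.mul_self_mul_inv_not_mem (hRC : D.RingClassFourBlockSpec d ΓH ΓH' ρ)
    (hS : D.ThetaSignatureBlockSpec d θ) (hθ : θ ∈ D.galK d) {g : D.H ≃ₐ[ℚ] D.H} (hgK : g ∈ D.galK d) :
    g * g * θ⁻¹ ∉ ΓH' := by
  intro hmem
  apply hS.not_isSquare_rho hRC hθ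
  refine ⟨ρ ⟨g, hgK⟩, ?_⟩
  have e : ρ (⟨g, hgK⟩ * ⟨g, hgK⟩ * ⟨θ, hθ⟩⁻¹) = 1 := (hRC.2.1 _).2 hmem
  rw [map_mul, map_inv, mul_inv_eq_one, map_mul] at e
  exact e.symm

end Four

/-! ## §6 Blocks `d ≡ 5 (mod 8)` (conductor `2`): `ker(Pic(𝒪₂) → Cl(𝒪_{K_d})) = {1, ρ₂(σ)}` -/

section Two

variable {ρ : D.galK d →* RingClassGroup (GenusField d) 2}

/-- `ρ₂(σ) ≠ 1` ((RC1): `ker ρ₂ = Gal(ℍ′_n/H′_d) ∌ σ`). [cite: TianYuanZhang2017, Prop. 3.2 (1) (p0010 L106–L109), §3.1 (p0011 L3)] -/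
theorem RingClassTwoBlockSpec.rho_sigma_ne_one (hRC : D.RingClassTwoBlockSpec d ΓH ΓH' ρ)
    (h : D.CMBlockSpec d z Φ ΓH ΓH' σ c) : ρ ⟨σ, h.sigma_mem_galK⟩ ≠ 1 :=
  fun e => h.sigma_not_mem ((hRC.2.1 _).1 e)

/-- `ρ₂(σ)·ρ₂(σ) = 1`. [cite: TianYuanZhang2017, Prop. 3.2 (1), §3.1 (p0011 L3)] -/
theorem RingClassTwoBlockSpec.rho_sigma_mul_self (hRC : D.RingClassTwoBlockSpec d ΓH ΓH' ρ)
    (h : D.CMBlockSpec d z Φ ΓH ΓH' σ c) : ρ ⟨σ, h.sigma_mem_galK⟩ * ρ ⟨σ, h.sigma_mem_galK⟩ = 1 := by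
  rw [← map_mul]
  exact (hRC.2.1 _).2 h.2.2.2.2.2.1.2.1

/-- `orderOf ρ₂(σ) = 2`. [cite: TianYuanZhang2017, Prop. 3.2 (1), §3.1 (p0011 L3)] -/
theorem RingClassTwoBlockSpec.orderOf_rho_sigma (hRC : D.RingClassTwoBlockSpec d ΓH ΓH' ρ)
    (h : D.CMBlockSpec d z Φ ΓH ΓH' σ c) : orderOf (ρ ⟨σ, h.sigma_mem_galK⟩) = 2 :=
  orderOf_eq_prime (by simpa [pow_two] using hRC.rho_sigma_mul_self h) (hRC.rho_sigma_ne_one h)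

/-- `ρ₂(σ) ∈ ker(Pic(𝒪₂) → Cl(𝒪_{K_d}))`. [cite: TianYuanZhang2017, Prop. 3.2 (1), §3.1 (p0011 L3)] [cite: Cox2013, §9.A (pp. 180–181)] -/
theorem RingClassTwoBlockSpec.toClassGroup_rho_sigma (hRC : D.RingClassTwoBlockSpec d ΓH ΓH' ρ)
    (h : D.CMBlockSpec d z Φ ΓH ΓH' σ c) : toClassGroup (GenusField d) 2 (ρ ⟨σ, h.sigma_mem_galK⟩) = 1 :=
  (hRC.2.2.1 _).2 h.2.2.2.2.2.1.1

/-- **`ker(Pic(𝒪₂)(K_d) → Cl(𝒪_{K_d})) = {1, ρ₂(σ_d)}`** for a square-free block `d ≡ 5 (mod 8)` (the kernel has `2` elements, Cox Thm. 7.24;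
"`Gal(H′_n/H_n) ≃ ℤ/2ℤ`"). [cite: TianYuanZhang2017, Prop. 3.2 (1) (p0010 L106–L109), §3.1 (p0011 L3)] [cite: Cox2013, §7.D Thm. 7.24 and (7.27), §9.A] -/
theorem RingClassTwoBlockSpec.eq_one_or_eq_rho_sigma (hRC : D.RingClassTwoBlockSpec d ΓH ΓH' ρ)
    (h : D.CMBlockSpec d z Φ ΓH ΓH' σ c) (hsq : Squarefree d) (hd5 : d % 8 = 5)
    {x : RingClassGroup (GenusField d) 2} (hx : toClassGroup (GenusField d) 2 x = 1) :
    x = 1 ∨ x = ρ ⟨σ, h.sigma_mem_galK⟩ := by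
  have hcard := natCard_ker_toClassGroup_two_genusField hsq (Or.inl hd5)
  obtain ⟨y, -, hy⟩ := (Nat.card_eq_two_iff' (1 : (toClassGroup (GenusField d) 2).ker)).mp hcard
  by_cases hx1 : x = 1
  · exact Or.inl hx1
  · right
    have e1 : (⟨x, hx⟩ : (toClassGroup (GenusField d) 2).ker) = y :=
      hy _ (fun e => hx1 (congrArg Subtype.val e))
    have e2 : (⟨ρ ⟨σ, h.sigma_mem_galK⟩, hRC.toClassGroup_rho_sigma h⟩ : (toClassGroup (GenusField d) 2).ker) = y :=
      hy _ (fun e => hRC.rho_sigma_ne_one h (congrArg Subtype.val e))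
    exact congrArg Subtype.val (e1.trans e2.symm)

/-- **Galois form of §6** (square-free block `d ≡ 5 (mod 8)`): every `g ∈ Gal(ℍ′_n/H_d)` is `≡ 1` or `≡ σ` modulo `Gal(ℍ′_n/H′_d)`
(`Gal(H′_d/H_d) ≅ ℤ/2`). [cite: TianYuanZhang2017, Prop. 3.2 (1) (p0010 L106–L109), §3.1 (p0011 L3)] -/
theorem RingClassTwoBlockSpec.mem_or_mul_inv_sigma_mem (hRC : D.RingClassTwoBlockSpec d ΓH ΓH' ρ)
    (h : D.CMBlockSpec d z Φ ΓH ΓH' σ c) (hsq : Squarefree d) (hd5 : d % 8 = 5)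
    {g : D.H ≃ₐ[ℚ] D.H} (hg : g ∈ ΓH) : g ∈ ΓH' ∨ g * σ⁻¹ ∈ ΓH' := by
  have hgK : g ∈ D.galK d := h.mem_galK_of_mem hg
  have hx : toClassGroup (GenusField d) 2 (ρ ⟨g, hgK⟩) = 1 := (hRC.2.2.1 ⟨g, hgK⟩).2 hg
  rcases hRC.eq_one_or_eq_rho_sigma h hsq hd5 hx with e | e
  · exact Or.inl ((hRC.2.1 ⟨g, hgK⟩).1 e)
  · right
    have : ρ (⟨g, hgK⟩ * ⟨σ, h.sigma_mem_galK⟩⁻¹) = 1 := by rw [map_mul, map_inv, e, mul_inv_cancel]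
    exact (hRC.2.1 _).1 this

end Two

end GenusPointData

end Literature.NumberTheory.EllipticCurves.TianYuanZhang2017

end
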